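/-
Copyright: the b2b-balaban T⁴-continuum CRUX team, row NE7b leaf lineage `t4-ne7b-formalise-leaf-03` (gen 148). Project licence.
-/
import Summits.QuantumFields.BalabanUV.T4Continuum.Spine.NE7b.AugmentedHessianEquivalence

/-!
# THE HARD STEP WITH A NONLINEAR CONSTRAINT: THE PRIMAL–DUAL (KKT) OPERATOR `(h, μ) ↦ (T h, Q h − μ ∘ T)` IS AN EQUIVALENCE
# `E × (F →L ℝ) ≃L F × (E →L ℝ)` WITH AN EXPLICIT INVERSE BOUND, FROM KERNEL COERCIVITY OF THE LAGRANGIAN FORM ALONE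
# (row NE7b, node U5c; idea-1 T-85 (L2) ∕ TRANSFER row (xxiv) «group-valued `Q_k`: Lagrangian Hessian `𝓛 = D²V − λ∘D²G`» — CMP 98
# Prop. 4, [B9] (3.127)–(3.128) ∕ (3.156); T-93 (b) «implicit function on a chart WITH CONSTANTS», [B11] CMP 102 (70)–(71); the chart
# letters `T`, `‖T⁻¹ y‖ ≤ N‖y‖` of `…HardStepChartRadius.exists_sliceBranch` for the KKT map `δ, λ ↦ (G δ, DV(δ) − λ ∘ DG(δ))`;
# companion of `…AugmentedHessianEquivalence` (the linear-constraint ∕ reduced form); [folklore])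

Cell `pub-balaban`, sub-cell `t4`, spine estimate NE7b (`T4WeightBudget.RelWeightBound`; the cell's OWN estimate — NOT PRINTED
in [Bałaban 1983–89], NOT PROVED).  Crux-route work under `Spine/NE7b/` by leaf-03 (CRUX team (2), FREEZE (0) crux-prover clause).
NOTHING of Bałaban's is named, asserted, valued or discharged; no `T4Continuum/Support` leaf typed; no `def`; zero `sorry`.  Imports
ONLY this lineage's `…AugmentedHessianEquivalence` (AHE: the a-priori bound `norm_le_of_kerCoercive`, injectivity `eq_of_aug_eq`,
solvability `exists_aug_eq` — Mathlib `LaxMilgram` ∕ `InnerProductSpace.Dual` behind it).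

WHY.  With a NONLINEAR constraint `G δ = w` (print's group-valued averaging, CMP 98 Prop. 4: `Q_k(U₀, ηA) = Q_k(U₀)A + C_k(U₀, A)`),
the hard step's critical points are the KKT pairs `(δ, λ)`: `G δ = w`, `DV(δ) = λ ∘ DG(δ)` (`…ConstrainedMinimiserRegularNonlinear`,
`…ConstrainedValueLagrangian`).  The chart for the branch `w ↦ (δ(w), λ(w))` is `…HardStepChartRadius.exists_sliceBranch` applied to
the primal–dual map `Φ(δ, λ) = (G δ, DV(δ) − λ ∘ DG(δ))` on `E × (F →L ℝ)`, whose linearisation at `(δ₀, λ₀)` is the KKT operator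
`𝒦(h, μ) = (T h, Q h − μ ∘ T)` with `T = DG(δ₀)` and `Q = D²V(δ₀) − λ₀ ∘ D²G(δ₀)` the LAGRANGIAN form.  HSCR displays `𝒦` as an
equivalence with `‖𝒦⁻¹ y‖ ≤ N‖y‖`; this file supplies both from the kernel coercivity of `Q` on `ker T` (the second-order
sufficient condition — `…ConstrainedValueSection.le_lagrangianForm_of_firstOrderG` derives it from the strong first-order letter)
and a right inverse `N` of `T`.  The primal column is AHE's `T⁻¹(k, ψ|_{ker T})`; the multiplier is read off through `N`:
`μ = (Q h − ψ) ∘ N`.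

WHAT IS PROVED ([folklore]; nonsingularity of the KKT operator under LICQ + SOSC — Nocedal–Wright Lemma 16.1; in Hilbert space
Brezzi's splitting (RAIRO 8 (1974)) — here with the explicit inverse bound).  Standing letters: `E` real inner-product space (complete
for §2–§3), `F` real normed, `Q : E →L[ℝ] E →L[ℝ] ℝ` (NO symmetry), `T : E →L[ℝ] F`, `N : F →L[ℝ] E` with `T (N w) = w`, `0 < m`,
`∀ κ, T κ = 0 → m‖κ‖² ≤ Q κ κ`; `A := (1 + ‖Q‖∕m)‖N‖ + m⁻¹`.
* §1 (no completeness) `comp_rightInverse_eq_of_ker` (a functional killing `ker T` factors through `T`: `ℓ = (ℓ ∘ N) ∘ T`),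
  `eq_zero_of_comp_eq_zero` (`μ ∘ T = 0 ⟹ μ = 0`), **`kkt_apriori`** (for EVERY `(h, μ)` with `𝒦(h, μ) = (k, ψ)`:
  `‖h‖ ≤ A‖(k, ψ)‖` and `‖μ‖ ≤ ‖N‖(‖Q‖A + 1)‖(k, ψ)‖`), `kkt_injective`.
* §2 **`exists_kkt_eq`** (`E` complete): every `(k, ψ)` is `(T h, Q h − μ ∘ T)` — `h` from AHE `exists_aug_eq` at `(k, ψ|_{ker T})`,
  `μ := (Q h − ψ) ∘ N`.
* §3 THE END **`exists_kkt_equiv`** — `∃ K : (E × (F →L[ℝ] ℝ)) ≃L[ℝ] (F × (E →L[ℝ] ℝ))`, `∀ h μ, K (h, μ) = (T h, Q h − μ.comp T)` and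
  `∀ y, ‖K.symm y‖ ≤ (A + ‖N‖(‖Q‖A + 1))·‖y‖`; **`exists_kkt_equiv_nnreal`** — the same for any `N' : ℝ≥0` dominating the
  constant (`…HardStepChartRadius.exists_sliceBranch`'s binders `T`, `hN` for the primal–dual chart).
* §4 `fst_kkt_symm` ∕ `snd_kkt_symm` (reading the inverse), **`norm_fst_kkt_symm_le`** (the PRIMAL column alone: `‖(K⁻¹ y).1‖ ≤ A‖y‖`).
* §5 toy (`example`): `E = F = ℝ`, `T = N = id`, `Q x y = x·y`: `𝒦(h, μ) = (h, h − μ)`; §1's primal bound at `m = 1`.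

NOT HERE (honest): which `V, G, λ₀` are Bałaban's ((A3) ∕ (A1c), NC-NE7b-α UNRULED); the smallness letter of the primal–dual chart
(`‖DΦ(δ, λ) − 𝒦‖ ≤ c` on a ball: needs `D²V`, `D²G` Lipschitz AND `‖λ − λ₀‖` small — a separate letter); symmetric-`Q` ∕ saddle-point
refinements (Brezzi's sharp constants); Banach (non-Hilbert) `E`.  BY-NAME EFFECT ON THE WALL: NONE.  NE7b NOT PRINTED ∕ NOT PROVED;
spine PROVED 0∕9; rung (B)+1 on a FINITE torus — NOT infinite volume, NOT the mass gap, NOT Clay.  HONEST DEPENDENCY: continuum YM on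
T⁴ ⇐ BetaPertH ∧ nine spine estimates (0/9 proved); BetaPertH ⇐ (D1) ∧ (D4) ∧ CAP+tail; G-an2-4 gates asym, D1 and NE2∕3∕4.
-/

set_option autoImplicit false

noncomputable section

namespace Summit.QuantumFields.BalabanUV.T4Continuum.NE7b.AugmentedLagrangianEquivalence

open Summit.QuantumFields.BalabanUV.T4Continuum.NE7b.AugmentedHessianEquivalence
  (norm_le_of_kerCoercive eq_of_aug_eq exists_aug_eq comp_subtypeL_apply sub_rightInverse_mem_ker)
open scoped NNReal

variable {E F : Type*} [NormedAddCommGroup E] [InnerProductSpace ℝ E] [NormedAddCommGroup F] [NormedSpace ℝ F]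

/-! ## §1. Algebra and the a-priori bounds (no completeness) -/

/-- A functional killing `ker T` factors through `T` via ANY right inverse `N`: `ℓ = (ℓ ∘ N) ∘ T`. [folklore] -/
theorem comp_rightInverse_eq_of_ker {T : E →L[ℝ] F} {N : F →L[ℝ] E} (hN : ∀ w, T (N w) = w) {ℓ : E →L[ℝ] ℝ}
    (hℓ : ∀ κ, T κ = 0 → ℓ κ = 0) : (ℓ.comp N).comp T = ℓ := by
  ext x
  have hx : T (x - N (T x)) = 0 := by rw [map_sub, hN, sub_self]
  have h0 := hℓ _ hx
  rw [map_sub, sub_eq_zero] at h0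
  simp [h0.symm]

/-- `μ ∘ T = 0 ⟹ μ = 0` when `T` has a right inverse. [folklore] -/
theorem eq_zero_of_comp_eq_zero {T : E →L[ℝ] F} {N : F →L[ℝ] E} (hN : ∀ w, T (N w) = w) {μ : F →L[ℝ] ℝ}
    (hμ : μ.comp T = 0) : μ = 0 := by
  ext w
  have h := congrArg (fun L : E →L[ℝ] ℝ => L (N w)) hμ
  simpa [hN] using h

/-- The restriction to `ker T` of `Q h − μ ∘ T` is that of `Q h` (the multiplier term dies on the kernel). [folklore] -/
theorem comp_subtypeL_sub_comp {Q : E →L[ℝ] E →L[ℝ] ℝ} {T : E →L[ℝ] F} (h : E) (μ : F →L[ℝ] ℝ) :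
    (Q h - μ.comp T).comp T.ker.subtypeL = (Q h).comp T.ker.subtypeL := by
  ext z
  have hz : T (z : E) = 0 := by
    have := z.2
    rw [LinearMap.mem_ker] at this
    exact this
  simp [hz]

/-- Restriction to the kernel does not increase the norm: `‖ψ|_{ker T}‖ ≤ ‖ψ‖`. [folklore] -/
theorem norm_comp_subtypeL_le {T : E →L[ℝ] F} (ψ : E →L[ℝ] ℝ) : ‖ψ.comp T.ker.subtypeL‖ ≤ ‖ψ‖ :=
  (ψ.opNorm_comp_le _).trans (mul_le_of_le_one_right (norm_nonneg _) (Submodule.norm_subtypeL_le _))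

/-- **THE A-PRIORI BOUNDS FOR A KKT PAIR.**  If `T h = k` and `Q h − μ ∘ T = ψ` then, with `A := (1 + ‖Q‖∕m)‖N‖ + m⁻¹`,
`‖h‖ ≤ A·‖(k, ψ)‖` (AHE's bound at `(k, ψ|_{ker T})`) and `‖μ‖ ≤ ‖N‖(‖Q‖A + 1)·‖(k, ψ)‖` (`μ = (Q h − ψ) ∘ N`). [folklore] -/
theorem kkt_apriori {Q : E →L[ℝ] E →L[ℝ] ℝ} {T : E →L[ℝ] F} {N : F →L[ℝ] E} (hN : ∀ w, T (N w) = w)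
    {m : ℝ} (hm : 0 < m) (hco : ∀ κ, T κ = 0 → m * ‖κ‖ ^ 2 ≤ Q κ κ) {h : E} {μ : F →L[ℝ] ℝ} {k : F} {ψ : E →L[ℝ] ℝ}
    (hk : T h = k) (hψ : Q h - μ.comp T = ψ) :
    ‖h‖ ≤ ((1 + ‖Q‖ / m) * ‖N‖ + m⁻¹) * ‖(k, ψ)‖ ∧
      ‖μ‖ ≤ ‖N‖ * (‖Q‖ * ((1 + ‖Q‖ / m) * ‖N‖ + m⁻¹) + 1) * ‖(k, ψ)‖ := by
  have hC : 0 ≤ 1 + ‖Q‖ / m := by positivity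
  have hkn : ‖k‖ ≤ ‖(k, ψ)‖ := norm_fst_le (k, ψ)
  have hψn : ‖ψ‖ ≤ ‖(k, ψ)‖ := norm_snd_le (k, ψ)
  -- the primal bound
  have hres : (Q h).comp T.ker.subtypeL = ψ.comp T.ker.subtypeL := by
    rw [← hψ, comp_subtypeL_sub_comp]
  have h1 := norm_le_of_kerCoercive (Q := Q) (D := T) (M := N) hN hm hco h
  rw [hk, hres] at h1
  have hh : ‖h‖ ≤ ((1 + ‖Q‖ / m) * ‖N‖ + m⁻¹) * ‖(k, ψ)‖ := by
    calc ‖h‖ ≤ (1 + ‖Q‖ / m) * ‖N k‖ + m⁻¹ * ‖ψ.comp T.ker.subtypeL‖ := h1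
      _ ≤ (1 + ‖Q‖ / m) * (‖N‖ * ‖(k, ψ)‖) + m⁻¹ * ‖(k, ψ)‖ := by
          gcongr
          · exact (N.le_opNorm k).trans (mul_le_mul_of_nonneg_left hkn (norm_nonneg _))
          · exact (norm_comp_subtypeL_le ψ).trans hψn
      _ = ((1 + ‖Q‖ / m) * ‖N‖ + m⁻¹) * ‖(k, ψ)‖ := by ring
  refine ⟨hh, ?_⟩
  -- the multiplier: `μ = (Q h − ψ) ∘ N`
  have hμ : μ = (Q h - ψ).comp N := by
    ext w
    have e := congrArg (fun L : E →L[ℝ] ℝ => L (N w)) hψ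
    have e' : Q h (N w) - μ (T (N w)) = ψ (N w) := e
    rw [hN] at e'
    show μ w = Q h (N w) - ψ (N w)
    linarith
  have hA : 0 ≤ ((1 + ‖Q‖ / m) * ‖N‖ + m⁻¹) := by positivity
  calc ‖μ‖ = ‖(Q h - ψ).comp N‖ := by rw [← hμ]
    _ ≤ ‖Q h - ψ‖ * ‖N‖ := ContinuousLinearMap.opNorm_comp_le _ _
    _ ≤ (‖Q h‖ + ‖ψ‖) * ‖N‖ := mul_le_mul_of_nonneg_right (norm_sub_le _ _) (norm_nonneg _)
    _ ≤ (‖Q‖ * ‖h‖ + ‖(k, ψ)‖) * ‖N‖ := by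
        gcongr
        · exact Q.le_opNorm h
    _ ≤ (‖Q‖ * (((1 + ‖Q‖ / m) * ‖N‖ + m⁻¹) * ‖(k, ψ)‖) + ‖(k, ψ)‖) * ‖N‖ := by gcongr
    _ = ‖N‖ * (‖Q‖ * ((1 + ‖Q‖ / m) * ‖N‖ + m⁻¹) + 1) * ‖(k, ψ)‖ := by ring

/-- INJECTIVITY of the KKT operator. [folklore] -/
theorem kkt_injective {Q : E →L[ℝ] E →L[ℝ] ℝ} {T : E →L[ℝ] F} {N : F →L[ℝ] E} (hN : ∀ w, T (N w) = w)
    {m : ℝ} (hm : 0 < m) (hco : ∀ κ, T κ = 0 → m * ‖κ‖ ^ 2 ≤ Q κ κ) {h h' : E} {μ μ' : F →L[ℝ] ℝ}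
    (hT : T h = T h') (hQ : Q h - μ.comp T = Q h' - μ'.comp T) : h = h' ∧ μ = μ' := by
  have hres : (Q h).comp T.ker.subtypeL = (Q h').comp T.ker.subtypeL := by
    rw [← comp_subtypeL_sub_comp h μ, hQ, comp_subtypeL_sub_comp]
  have hh : h = h' := eq_of_aug_eq (Q := Q) (D := T) (M := N) hN hm hco hT hres
  refine ⟨hh, ?_⟩
  subst hh
  have e : (μ - μ').comp T = 0 := by
    rw [ContinuousLinearMap.sub_comp]
    have := congrArg (fun L : E →L[ℝ] ℝ => Q h - L) hQ
    simp only [sub_sub_cancel] at this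
    rw [this, sub_self]
  exact sub_eq_zero.mp (eq_zero_of_comp_eq_zero hN e)

/-! ## §2. Solvability (`E` complete): AHE's solve on the kernel, multiplier through `N` -/

/-- **SOLVABILITY OF THE KKT SYSTEM**: every `(k, ψ) : F × (E →L[ℝ] ℝ)` is `(T h, Q h − μ ∘ T)` — `h` from
`…AugmentedHessianEquivalence.exists_aug_eq` at `(k, ψ|_{ker T})`, then `μ := (Q h − ψ) ∘ N` (the functional `Q h − ψ` kills `ker T`,
so it factors through `T`). [folklore] -/
theorem exists_kkt_eq [CompleteSpace E] {Q : E →L[ℝ] E →L[ℝ] ℝ} {T : E →L[ℝ] F} {N : F →L[ℝ] E}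
    (hN : ∀ w, T (N w) = w) {m : ℝ} (hm : 0 < m) (hco : ∀ κ, T κ = 0 → m * ‖κ‖ ^ 2 ≤ Q κ κ)
    (k : F) (ψ : E →L[ℝ] ℝ) :
    ∃ (h : E) (μ : F →L[ℝ] ℝ), T h = k ∧ Q h - μ.comp T = ψ := by
  obtain ⟨h, hk, hres⟩ := exists_aug_eq (Q := Q) (D := T) (M := N) hN hm hco k (ψ.comp T.ker.subtypeL)
  refine ⟨h, (Q h - ψ).comp N, hk, ?_⟩
  have hker : ∀ κ, T κ = 0 → (Q h - ψ) κ = 0 := by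
    intro κ hκ
    have hκmem : κ ∈ T.ker := LinearMap.mem_ker.mpr hκ
    have e := congrArg (fun L : T.ker →L[ℝ] ℝ => L ⟨κ, hκmem⟩) hres
    simp only [comp_subtypeL_apply] at e
    have e' : ψ κ = Q h κ := by simpa using e.symm
    simp [e']
  rw [comp_rightInverse_eq_of_ker hN hker, sub_sub_cancel]

/-! ## §3. The END: the KKT operator is an equivalence with an explicit inverse bound -/

/-- **THE KKT OPERATOR IS AN EQUIVALENCE WITH `‖K⁻¹ y‖ ≤ (A + ‖N‖(‖Q‖A + 1))‖y‖`, `A = (1 + ‖Q‖∕m)‖N‖ + m⁻¹`.**  Real Hilbert `E`,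
real normed `F`, `Q : E →L E →L ℝ` with `m‖κ‖² ≤ Q κ κ` on `ker T` (`0 < m`), `T (N w) = w` ⟹ there is
`K : (E × (F →L[ℝ] ℝ)) ≃L[ℝ] (F × (E →L[ℝ] ℝ))` with `K (h, μ) = (T h, Q h − μ.comp T)` and the pointwise inverse bound (sup norms). [folklore] -/
theorem exists_kkt_equiv [CompleteSpace E] {Q : E →L[ℝ] E →L[ℝ] ℝ} {T : E →L[ℝ] F} {N : F →L[ℝ] E}
    (hN : ∀ w, T (N w) = w) {m : ℝ} (hm : 0 < m) (hco : ∀ κ, T κ = 0 → m * ‖κ‖ ^ 2 ≤ Q κ κ) :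
    ∃ K : (E × (F →L[ℝ] ℝ)) ≃L[ℝ] (F × (E →L[ℝ] ℝ)),
      (∀ (h : E) (μ : F →L[ℝ] ℝ), K (h, μ) = (T h, Q h - μ.comp T)) ∧
      ∀ y, ‖K.symm y‖ ≤ (((1 + ‖Q‖ / m) * ‖N‖ + m⁻¹) +
        ‖N‖ * (‖Q‖ * ((1 + ‖Q‖ / m) * ‖N‖ + m⁻¹) + 1)) * ‖y‖ := by
  -- the forward map as a continuous linear map: `(h, μ) ↦ (T h, Q h − μ ∘ T)`
  set R : (F →L[ℝ] ℝ) →L[ℝ] (E →L[ℝ] ℝ) := (ContinuousLinearMap.compL ℝ E F ℝ).flip T with hR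
  have hRapply : ∀ μ : F →L[ℝ] ℝ, R μ = μ.comp T := fun μ => rfl
  set K₀ : (E × (F →L[ℝ] ℝ)) →L[ℝ] (F × (E →L[ℝ] ℝ)) :=
    (T.comp (ContinuousLinearMap.fst ℝ E (F →L[ℝ] ℝ))).prod
      ((Q : E →L[ℝ] E →L[ℝ] ℝ).comp (ContinuousLinearMap.fst ℝ E (F →L[ℝ] ℝ)) -
        R.comp (ContinuousLinearMap.snd ℝ E (F →L[ℝ] ℝ))) with hK₀
  have hK₀apply : ∀ (h : E) (μ : F →L[ℝ] ℝ), K₀ (h, μ) = (T h, Q h - μ.comp T) := fun h μ => rfl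
  -- the inverse as a function, by §2
  choose gh gμ hgT hgQ using fun y : F × (E →L[ℝ] ℝ) => exists_kkt_eq hN hm hco y.1 y.2
  set g : (F × (E →L[ℝ] ℝ)) → (E × (F →L[ℝ] ℝ)) := fun y => (gh y, gμ y) with hg
  have hKg : ∀ y, K₀ (g y) = y := fun y => by
    rw [hg, hK₀apply, hgT, hgQ]
  have huniq : ∀ y x, K₀ x = y → x = g y := fun y x hx => by
    obtain ⟨h, μ⟩ := x
    rw [hK₀apply] at hx
    have hx' := hx.trans (hKg y).symm
    rw [hg, hK₀apply, Prod.mk.injEq] at hx'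
    obtain ⟨e1, e2⟩ := kkt_injective hN hm hco hx'.1 hx'.2
    rw [hg, e1, e2]
  -- linearity from uniqueness
  have hadd : ∀ y y', g (y + y') = g y + g y' := fun y y' =>
    (huniq _ _ (by rw [map_add, hKg, hKg])).symm
  have hsmul : ∀ (c : ℝ) (y), g (c • y) = c • g y := fun c y =>
    (huniq _ _ (by rw [map_smul, hKg])).symm
  obtain ⟨glin, hglin⟩ : ∃ glin : (F × (E →L[ℝ] ℝ)) →ₗ[ℝ] (E × (F →L[ℝ] ℝ)), ∀ y, glin y = g y :=
    ⟨{ toFun := g, map_add' := hadd, map_smul' := hsmul }, fun y => rfl⟩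
  -- boundedness from §1
  have hbound : ∀ y, ‖g y‖ ≤ (((1 + ‖Q‖ / m) * ‖N‖ + m⁻¹) +
      ‖N‖ * (‖Q‖ * ((1 + ‖Q‖ / m) * ‖N‖ + m⁻¹) + 1)) * ‖y‖ := fun y => by
    obtain ⟨hh, hμ⟩ := kkt_apriori hN hm hco (hgT y) (hgQ y)
    have hy : ((y.1, y.2) : F × (E →L[ℝ] ℝ)) = y := rfl
    rw [hy] at hh hμ
    have hA : 0 ≤ ((1 + ‖Q‖ / m) * ‖N‖ + m⁻¹) * ‖y‖ := by positivity
    have hB : 0 ≤ ‖N‖ * (‖Q‖ * ((1 + ‖Q‖ / m) * ‖N‖ + m⁻¹) + 1) * ‖y‖ := by positivity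
    calc ‖g y‖ = max ‖gh y‖ ‖gμ y‖ := rfl
      _ ≤ ((1 + ‖Q‖ / m) * ‖N‖ + m⁻¹) * ‖y‖ + ‖N‖ * (‖Q‖ * ((1 + ‖Q‖ / m) * ‖N‖ + m⁻¹) + 1) * ‖y‖ :=
          max_le (hh.trans (le_add_of_nonneg_right hB)) (hμ.trans (le_add_of_nonneg_left hA))
      _ = _ := by ring
  have hcont : Continuous glin :=
    AddMonoidHomClass.continuous_of_bound glin _ fun y => by rw [hglin]; exact hbound y
  obtain ⟨S, hSapply⟩ : ∃ S : (F × (E →L[ℝ] ℝ)) →L[ℝ] (E × (F →L[ℝ] ℝ)), ∀ y, S y = g y :=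
    ⟨{ toLinearMap := glin, cont := hcont }, fun y => hglin y⟩
  refine ⟨ContinuousLinearEquiv.equivOfInverse K₀ S (fun x => ?_) (fun y => ?_), fun h μ => rfl, fun y => ?_⟩
  · show S (K₀ x) = x
    rw [hSapply]
    exact (huniq _ _ rfl).symm
  · show K₀ (S y) = y
    rw [hSapply]
    exact hKg y
  · rw [ContinuousLinearEquiv.symm_equivOfInverse, ContinuousLinearEquiv.equivOfInverse_apply, hSapply]
    exact hbound y

/-- **THE SAME IN `ℝ≥0` CURRENCY** (`…HardStepChartRadius.exists_sliceBranch` ∕ `exists_localInverse_closedBall`'s binders `T`, `hN` for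
the primal–dual map): any `N' : ℝ≥0` dominating the constant works. [folklore] -/
theorem exists_kkt_equiv_nnreal [CompleteSpace E] {Q : E →L[ℝ] E →L[ℝ] ℝ} {T : E →L[ℝ] F} {N : F →L[ℝ] E}
    (hN : ∀ w, T (N w) = w) {m : ℝ} (hm : 0 < m) (hco : ∀ κ, T κ = 0 → m * ‖κ‖ ^ 2 ≤ Q κ κ) {N' : ℝ≥0}
    (hN' : ((1 + ‖Q‖ / m) * ‖N‖ + m⁻¹) + ‖N‖ * (‖Q‖ * ((1 + ‖Q‖ / m) * ‖N‖ + m⁻¹) + 1) ≤ (N' : ℝ)) :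
    ∃ K : (E × (F →L[ℝ] ℝ)) ≃L[ℝ] (F × (E →L[ℝ] ℝ)),
      (∀ (h : E) (μ : F →L[ℝ] ℝ), K (h, μ) = (T h, Q h - μ.comp T)) ∧
      ∀ y : F × (E →L[ℝ] ℝ), ‖K.symm y‖ ≤ N' * ‖y‖ := by
  obtain ⟨K, hK, hKN⟩ := exists_kkt_equiv hN hm hco
  exact ⟨K, hK, fun y => (hKN y).trans (mul_le_mul_of_nonneg_right hN' (norm_nonneg y))⟩

/-! ## §4. Reading the inverse -/

/-- `T ((K⁻¹ y).1) = y.1`. [folklore] -/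
theorem fst_kkt_symm {Q : E →L[ℝ] E →L[ℝ] ℝ} {T : E →L[ℝ] F} (K : (E × (F →L[ℝ] ℝ)) ≃L[ℝ] (F × (E →L[ℝ] ℝ)))
    (hK : ∀ (h : E) (μ : F →L[ℝ] ℝ), K (h, μ) = (T h, Q h - μ.comp T)) (y : F × (E →L[ℝ] ℝ)) :
    T (K.symm y).1 = y.1 := by
  have e := hK (K.symm y).1 (K.symm y).2
  rw [Prod.mk.eta, ContinuousLinearEquiv.apply_symm_apply] at e
  exact (congrArg Prod.fst e).symm

/-- `Q ((K⁻¹ y).1) − (K⁻¹ y).2 ∘ T = y.2`. [folklore] -/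
theorem snd_kkt_symm {Q : E →L[ℝ] E →L[ℝ] ℝ} {T : E →L[ℝ] F} (K : (E × (F →L[ℝ] ℝ)) ≃L[ℝ] (F × (E →L[ℝ] ℝ)))
    (hK : ∀ (h : E) (μ : F →L[ℝ] ℝ), K (h, μ) = (T h, Q h - μ.comp T)) (y : F × (E →L[ℝ] ℝ)) :
    Q (K.symm y).1 - (K.symm y).2.comp T = y.2 := by
  have e := hK (K.symm y).1 (K.symm y).2
  rw [Prod.mk.eta, ContinuousLinearEquiv.apply_symm_apply] at e
  exact (congrArg Prod.snd e).symm

/-- **THE PRIMAL COLUMN ALONE**: `‖(K⁻¹ y).1‖ ≤ ((1 + ‖Q‖∕m)‖N‖ + m⁻¹)·‖y‖` (no completeness; any `K` with the §3 reading). [folklore] -/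
theorem norm_fst_kkt_symm_le {Q : E →L[ℝ] E →L[ℝ] ℝ} {T : E →L[ℝ] F} {N : F →L[ℝ] E} (hN : ∀ w, T (N w) = w)
    {m : ℝ} (hm : 0 < m) (hco : ∀ κ, T κ = 0 → m * ‖κ‖ ^ 2 ≤ Q κ κ) (K : (E × (F →L[ℝ] ℝ)) ≃L[ℝ] (F × (E →L[ℝ] ℝ)))
    (hK : ∀ (h : E) (μ : F →L[ℝ] ℝ), K (h, μ) = (T h, Q h - μ.comp T)) (y : F × (E →L[ℝ] ℝ)) :
    ‖(K.symm y).1‖ ≤ ((1 + ‖Q‖ / m) * ‖N‖ + m⁻¹) * ‖y‖ := by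
  have h := (kkt_apriori hN hm hco (fst_kkt_symm K hK y) (snd_kkt_symm K hK y)).1
  rwa [Prod.mk.eta] at h

/-! ## §5. Toy -/

/-- Toy: `E = F = ℝ`, `T = N = id`, `Q x y = x·y` (`m = 1`, `ker T = 0`): the KKT operator is `(h, μ) ↦ (h, h − μ)`; §1's primal
bound reads `‖h‖ ≤ ((1 + ‖Q‖∕1)·‖id‖ + 1⁻¹)·‖(h, Q h − μ ∘ id)‖`. [folklore] -/
example (h : ℝ) (μ : ℝ →L[ℝ] ℝ) :
    ‖h‖ ≤ ((1 + ‖ContinuousLinearMap.mul ℝ ℝ‖ / 1) * ‖ContinuousLinearMap.id ℝ ℝ‖ + (1 : ℝ)⁻¹) *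
      ‖((ContinuousLinearMap.id ℝ ℝ) h, ContinuousLinearMap.mul ℝ ℝ h - μ.comp (ContinuousLinearMap.id ℝ ℝ))‖ :=
  (kkt_apriori (Q := ContinuousLinearMap.mul ℝ ℝ) (T := ContinuousLinearMap.id ℝ ℝ) (N := ContinuousLinearMap.id ℝ ℝ)
    (fun w => rfl) one_pos (fun κ hκ => by simp [show κ = 0 from hκ]) rfl rfl).1

end Summit.QuantumFields.BalabanUV.T4Continuum.NE7b.AugmentedLagrangianEquivalence
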